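import Summits.QuantumFields.YangMills.Theorems.AlphaInputsT3ACv4Chi
import Summits.QuantumFields.YangMills.Theorems.AlphaInputsT3ACv3RecordSelXsChi
import HarnessLib

/-!
# `AlphaInputsT3ACv4RecordSelXs` — P4 OF THE v4 PACKAGE PLAN: THE ONE-CURRENCY SELECTION DISPLAY OF 2′χ OVER THE VERSION-4 SOCKET, with the displayed seam row
# (71)_sym `SmallFactor71OfRecT3` in place of the undischargeable comb row `Large67CombOfRecT3` — lane `pub-balaban3d`, width seat alpha-2 (g7), ★★OWNER RULINGS g26-№8 ∕ №14

WHY (cell `ym3-torus`, route `UnitScaleTilt`, crux `HistoryTailL` = stmt-QuantumFields-19936; 2′χ in its version-4 text `AlphaInputsT3ACv4RecChi` (✓ `…v4Chi`) = the text of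
v5p10's stub `stub_laneRecordsV4Chi`).  The one-currency display ✓ `…v3RecordSelXsChi` reaches the v3 socket through the seam row `Large67CombOfRecT3` (recording ⇒ comb
(67)-largeness, feeding `hLF67`), LOCATED ✗ (★w6-19936 g2: the currencies agree to first order only); RULING g26-№14 replaced `hLF67` by the currency-free row `h71` (✓ `…v4Lane`),
whose SUPPLIER side is LEAD ★w1-19936 g3's ✓ `…SmallFactor71SymT3` (`h71_of_recLarge_of_eq69sym`: `large67RecSet ∩ reg68LocalSet` + (69)_sym + window ⇒ the `h71` text).  HERE:
§1 the displayed seam row `AlphaInputsT3AC.SmallFactor71OfRecT3 F 𝔠 γ hγ hγ1 K` («every member `U₀ ∈ 𝒞_Xs(k, h, W)` at an admissible history of level `k ≤ K` satisfies the `h71`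
text at every recorded code `e ∈ P(h)`»; explicit binders) + membership lemmas over `𝒞_Xs`; §2 the schema `DataSchemaT3ACXsChiSelV4` ((N1) ∧ seam row ∧ ∃ `Ut`, (D5) ∧ (O‴χₛ)) and
★ `AlphaInputsT3AC.ofV4ChiAt_of_dataSchemaT3XsChiSel : DataSchemaT3ACXsChiSelV4 F 𝔠 a₀ a₁ → AlphaInputsT3AC.OfV4ChiAt F 𝔠 a₀ a₁` (✓ `…DataSchemaSelChi` §2's assembly against
`RunAlphaV4ChiAC`: `h71` through the seam row, r2 ∕ r3 ∕ `h68` by membership in `𝒞_Xs` — NO passage through `𝒞_X`, NO comb letter); §3 `ofV4ChiAt_of_pinnedRows₂SelXsChi` ([7] Thm 1 +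
closed-form sizes); §4 the record display `AlphaInputsT3AC.PinnedPartsT3ACRecSelXsV4Chi L` (= `PinnedPartsT3ACRecSelXsChi L` with `Large67CombOfRecT3 ↦ SmallFactor71OfRecT3`) and
★★★ `alphaInputsT3ACv4RecChi_of_pinnedPartsRecSelXsV4Chi : … → AlphaInputsT3ACv4RecChi L`; §5 the one-supplier twins, ★★★ `laneRecordsV4Chi_of_thm1In8_selXsDataRows_allL`
(conclusion = the v5p10 stub text `∀ L, Odd L → 1 < L → AlphaInputsT3ACv4RecChi L`).  The door `⇒ HistoryTailL` is the v4 chain P5–P20 (W-hands), not this file.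
HONEST FRAMING.  `def … : Prop` below are HYPOTHESIS SCHEMAS, OPEN, never asserted; the theorems are bookkeeping around DISPLAYED rows of a conditional route.  (71)_sym is NOT
proved here (its discharge = LEAD's seam knit from the B1 team's (69)_sym pieces); (O‴χₛ) is print's own burden; nothing of the cluster expansion, of [Balaban1985Variational] Thm 1
or of [Balaban1985Averaging] is proved or asserted.  Count-neutral helper (`--supports stmt-QuantumFields-19936`); registry untouched.  YM₃ on the three-torus is rung R3 of the
programme, NOT the Clay problem: nothing here bears on d = 4, infinite volume, or a mass gap.

References: T. Bałaban, Commun. Math. Phys. 102 (1985) 255–275 [Balaban1985UV3] (Thm 2 p.272, (7) p.257, (40)–(42) p.266, (47) p.267, (67)–(71) p.273); Commun. Math. Phys.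
102 (1985) 277–309 [Balaban1985Variational] (Thm 1 (6)–(8) pp.278–279).
-/

set_option autoImplicit false

noncomputable section

namespace Summit.QuantumFields.YangMills.Theorems

open MeasureTheory Set
open scoped BigOperators Matrix Matrix.Norms.L2Operator
open Literature.MathematicalPhysics.QuantumFieldTheory.Balaban1983to89
open Literature.MathematicalPhysics.QuantumFieldTheory.Balaban1983to89.B10 (pFun)
open Literature.MathematicalPhysics.QuantumFieldTheory.Balaban1983to89.T3ContinuumYM3Torus
open Literature.MathematicalPhysics.QuantumFieldTheory.Balaban1983to89.T3UnitLawDensityEML (ℰp)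
open Literature.MathematicalPhysics.QuantumFieldTheory.Balaban1983to89.T3UnitScaleTilt (θBal)
open Literature.MathematicalPhysics.QuantumFieldTheory.Balaban1983to89.T3PrintedMinimiserExistence (Thm1GlobalMinAt)
open Literature.MathematicalPhysics.QuantumFieldTheory.Balaban1983to89.T3LowerAlongMinimisersSplit (MinimisersIn8At)
open Literature.MathematicalPhysics.QuantumFieldTheory.Balaban1983to89.ExpMeanLog (deltaSU)
open Literature.MathematicalPhysics.QuantumFieldTheory.Balaban1983to89.B10Eq38TorusDomains (plaqsIn)
open Literature.MathematicalPhysics.QuantumFieldTheory.Balaban1983to89.B10Eq42TorusConstraint (bondsIn lam42 lam42_self)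
open Literature.MathematicalPhysics.QuantumFieldTheory.Balaban1985CMP102
open Literature.MathematicalPhysics.QuantumFieldTheory.Balaban1985CMP102.Setting
open Summit.QuantumFields.Balaban3D.Carriers
open Summit.QuantumFields.Balaban3D.Proofs.Primitives
open Summit.QuantumFields.Balaban3D.Proofs.GroupModelLieC (lieC)
open Summit.QuantumFields.Balaban3D.Proofs.LiftBridge (liftCfg)
open Summit.QuantumFields.Balaban3D.Proofs.Run3SmallFactors (codeZ regionT)
open Summit.QuantumFields.Balaban3D.Proofs.TowerAC
open Summit.QuantumFields.Balaban3D.Proofs.StandardAC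
open Summit.QuantumFields.Balaban3D.Proofs.InputsAC
open Summit.QuantumFields.Balaban3D.Proofs.AlphaAC (AlphaDataAC)
open Summit.QuantumFields.Balaban3D.Proofs.Thresholds (Q0 Q0_pos)
open Summit.QuantumFields.YangMills.Theorems.AlphaV3AC
open Summit.QuantumFields.YangMills.Theorems.AlphaV4AC
open B7Prop1Local (pdevOn loK plaqHiK)
open B7Prop2Explicit (C0 C0_pos)

/-! ## §1 The displayed seam row (71)_sym over the one-currency class, and membership ⇒ the rows' texts -/

/-- **THE DISPLAYED SEAM ROW (71)_sym — THE v4 RUN ROW `h71` FOR MEMBERS OF THE ONE-CURRENCY CLASS** (hypothesis schema with explicit binders, OPEN, never asserted; ★★OWNER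
RULING g26-№14, replacing `Large67CombOfRecT3`): at every admissible history `h` of level `k ≤ K`, every datum `W` and every member `U₀ ∈ 𝒞_Xs(k, h, W)` (seam-blind small loops,
read-local (68), (67)-largeness in RECORDING currency, (42) + r3 when charged), for every recorded code `e = (j, code p′) ∈ P(h)`:
`p(g_j)²/4 ≤ N·((1/g_k²)·Σ_{q ∈ regionT e} η_k⁻¹[1 − reTr U₀(∂q)])` — LETTER FOR LETTER the field `AlphaV4AC.RunAlphaV4ChiAC.h71` at `U_k(h, W) := U₀` and the conclusion of
LEAD's supplier `AlphaInputsT3AC.h71_of_recLarge_of_eq69sym` (membership gives its `hLarge` ∕ `hReg`; (69)_sym and the window are the supplier's).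
[cite: Balaban1985UV3, (67)–(71) p.273] -/
def AlphaInputsT3AC.SmallFactor71OfRecT3 (F : T3Family) (𝔠 : AlphaConsts F.L (suGroupModel 2).N) (γ : ℝ) (hγ : 0 < γ)
    (hγ1 : γ ≤ (min 𝔠.gamma0 1) ^ 2) (K : ℕ) : Prop :=
  ∀ (k : ℕ), k ≤ K → ∀ (h : Hist (F.P K) k),
    Hist.Admissible 𝔠.lane.carrier.M₁ (rcolOf (T3Scales F γ hγ (hγ1.trans (sq_min_one_le _ 𝔠.gamma0_pos)) K) 𝔠.lane.carrier) k h →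
    ∀ (W : GaugeField (F.P K) k (Matrix.specialUnitaryGroup (Fin 2) ℂ)) (U₀ : GaugeField (F.P K) 0 (Matrix.specialUnitaryGroup (Fin 2) ℂ)),
      U₀ ∈ AlphaInputsT3AC.adaptedClassT3Xs F 𝔠 γ hγ hγ1 K k h W →
      ∀ (e : ℕ × PlaqCode (F.P K)), e ∈ Hist.disc h →
        pFun 𝔠.lane.carrier.b₀ 𝔠.lane.carrier.p₀ ((T3Scales F γ hγ (hγ1.trans (sq_min_one_le _ 𝔠.gamma0_pos)) K).gk e.1) ^ 2 / 4 ≤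
          ((suGroupModel 2).N : ℝ) * (((T3Scales F γ hγ (hγ1.trans (sq_min_one_le _ 𝔠.gamma0_pos)) K).gk k)⁻¹ ^ 2 *
            ∑ q ∈ regionT (S := T3Scales F γ hγ (hγ1.trans (sq_min_one_le _ 𝔠.gamma0_pos)) K) e,
              ((T3Scales F γ hγ (hγ1.trans (sq_min_one_le _ 𝔠.gamma0_pos)) K).eta k)⁻¹ * (1 - GaugeGroup.reTr (GaugeField.plaqHol U₀ q)))

section MemXs

variable {F : T3Family} {𝔠 : AlphaConsts F.L (suGroupModel 2).N} {γ : ℝ} {hγ : 0 < γ} {hγ1 : γ ≤ (min 𝔠.gamma0 1) ^ 2} {K : ℕ}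

/-- **MEMBERSHIP ⇒ ROW `h68`** for a member of `𝒞_Xs(k, h, W)`, `k ≤ K` — from the read-local (68) conjunct (`h68_of_mem_reg68LocalSet`). [cite: Balaban1985UV3, (68) p.273] -/
theorem AlphaInputsT3AC.h68_of_mem_adaptedClassT3Xs {k : ℕ} (hk : k ≤ K) {h : Hist (F.P K) k}
    {W : GaugeField (F.P K) k (Matrix.specialUnitaryGroup (Fin 2) ℂ)} {U : GaugeField (F.P K) 0 (Matrix.specialUnitaryGroup (Fin 2) ℂ)}
    (hU : U ∈ AlphaInputsT3AC.adaptedClassT3Xs F 𝔠 γ hγ hγ1 K k h W) :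
    ∀ e ∈ Hist.disc h,
      pdevOn (loK F.L e.1 (codeZ e)) (plaqHiK F.L e.1 (codeZ e) e.2.2.1 e.2.2.2)
          (liftCfg (S := T3Scales F γ hγ (hγ1.trans (sq_min_one_le _ 𝔠.gamma0_pos)) K) (suGroupModel 2) U) <
        𝔠.C68 * ((T3Scales F γ hγ (hγ1.trans (sq_min_one_le _ 𝔠.gamma0_pos)) K).gk e.1 *
          pFun 𝔠.lane.carrier.b₀ 𝔠.lane.carrier.p₀ ((T3Scales F γ hγ (hγ1.trans (sq_min_one_le _ 𝔠.gamma0_pos)) K).gk e.1)) *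
          (((F.L : ℝ) ^ e.1)⁻¹) ^ 2 :=
  AlphaInputsT3AC.h68_of_mem_reg68LocalSet (𝔠 := 𝔠) (hγ1 := hγ1) hk hU.2.1

/-- **MEMBERSHIP ⇒ ROW r2** for a charged datum: the top constraint (42) on the bonds of `Ω_k(h)`. [cite: Balaban1985UV3, (42) p.266] -/
theorem AlphaInputsT3AC.constraint42_of_mem_adaptedClassT3Xs {k : ℕ} {h : Hist (F.P K) k}
    {W : GaugeField (F.P K) k (Matrix.specialUnitaryGroup (Fin 2) ℂ)} {U : GaugeField (F.P K) 0 (Matrix.specialUnitaryGroup (Fin 2) ℂ)}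
    (hU : U ∈ AlphaInputsT3AC.adaptedClassT3Xs F 𝔠 γ hγ hγ1 K k h W)
    (hc : ChargedT3 F γ 𝔠.b₀ 𝔠.p₀ (avgWindowFactor F.L) K 𝔠.lane.carrier.M₁
      (rcolOf (T3Scales F γ hγ (hγ1.trans (sq_min_one_le _ 𝔠.gamma0_pos)) K) 𝔠.lane.carrier) k h W)
    (b : PBond (F.P K) k)
    (hb : b ∈ bondsIn k (Omega 𝔠.lane.carrier.M₁
      (rcolOf (T3Scales F γ hγ (hγ1.trans (sq_min_one_le _ 𝔠.gamma0_pos)) K) 𝔠.lane.carrier) k h k)) :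
    Averaging.iter (fun i => BlockAveraging.blockAvg (P := F.P K) (j := i) ℰp) k U b = W b :=
  (hU.2.2.2 hc).1 b hb

/-- **MEMBERSHIP ⇒ ROW r3** for a charged datum: the multi-level regularity (68). [cite: Balaban1985UV3, (68) p.273] -/
theorem AlphaInputsT3AC.regularity68Levels_of_mem_adaptedClassT3Xs {k : ℕ} {h : Hist (F.P K) k}
    {W : GaugeField (F.P K) k (Matrix.specialUnitaryGroup (Fin 2) ℂ)} {U : GaugeField (F.P K) 0 (Matrix.specialUnitaryGroup (Fin 2) ℂ)}
    (hU : U ∈ AlphaInputsT3AC.adaptedClassT3Xs F 𝔠 γ hγ hγ1 K k h W)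
    (hc : ChargedT3 F γ 𝔠.b₀ 𝔠.p₀ (avgWindowFactor F.L) K 𝔠.lane.carrier.M₁
      (rcolOf (T3Scales F γ hγ (hγ1.trans (sq_min_one_le _ 𝔠.gamma0_pos)) K) 𝔠.lane.carrier) k h W)
    (i : ℕ) (hi : i ≤ k) (s : ℕ) (hs : s ≤ i) (q : Plaq (F.P K) s)
    (hq : q ∈ plaqsIn s (lam42 (Omega 𝔠.lane.carrier.M₁
      (rcolOf (T3Scales F γ hγ (hγ1.trans (sq_min_one_le _ 𝔠.gamma0_pos)) K) 𝔠.lane.carrier) k h) k i)) :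
    GaugeGroup.dist1 (GaugeField.plaqHol
        (Averaging.iter (fun l => BlockAveraging.blockAvg (P := F.P K) (j := l) ℰp) s U) q) ≤
      𝔠.C68 * θBal F.L γ 𝔠.b₀ 𝔠.p₀ (K - i) * (((F.L : ℝ) ^ (i - s))⁻¹) ^ 2 :=
  (hU.2.2.2 hc).2 i hi s hs q hq

end MemXs

/-! ## §2 The schema over `𝒞_Xs` with the seam row (71)_sym, and the assembly to the v4 socket -/

/-- **`DataSchemaT3ACXsChiSelV4 F 𝔠 a₀ a₁` — THE ONE-CURRENCY SELECTION DATA SCHEMA FOR THE v4 SOCKET** (hypothesis schema, OPEN, never asserted): for every coupling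
`γ ∈ (0, (min γ₀ 1)²]` and run `K`: (N1) the window inequality, the displayed seam row (71)_sym, and a trivial-history minimiser family `Ut` with (D5) [7] Thm 1's rows and (O‴χₛ)
a handed selection in `𝒞_Xs` with its χ data rows. [cite: Balaban1985UV3, Thm 2 p.272 + (40)–(42) p.266 + (47) p.267 + (67)–(71) p.273; Balaban1985Variational, Thm 1 (8) p.279] -/
def DataSchemaT3ACXsChiSelV4 (F : T3Family) (𝔠 : AlphaConsts F.L (suGroupModel 2).N) (a₀ a₁ : ℝ) : Prop :=
  ∀ (γ : ℝ) (hγ : 0 < γ) (hγ1 : γ ≤ (min 𝔠.gamma0 1) ^ 2) (K : ℕ),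
    AlphaInputsT3AC.WindowIneqT3 F 𝔠 γ K ∧ AlphaInputsT3AC.SmallFactor71OfRecT3 F 𝔠 γ hγ hγ1 K ∧
    ∃ Ut : (k : ℕ) → GaugeField (F.P K) k (Matrix.specialUnitaryGroup (Fin 2) ℂ) → GaugeField (F.P K) 0 (Matrix.specialUnitaryGroup (Fin 2) ℂ),
      AlphaInputsT3AC.TrivMinimiserRowsT3 F 𝔠 γ hγ hγ1 a₀ a₁ K Ut ∧ AlphaInputsT3AC.DataRowsT3XsChiSel F 𝔠 γ hγ hγ1 K Ut

section Construction

variable {F : T3Family} {𝔠 : AlphaConsts F.L (suGroupModel 2).N} {a₀ a₁ : ℝ}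

/-- **★ THE v4 χ (α) PACKAGE FROM THE ONE-CURRENCY SELECTION SCHEMA: `DataSchemaT3ACXsChiSelV4 F 𝔠 a₀ a₁ → AlphaInputsT3AC.OfV4ChiAt F 𝔠 a₀ a₁`.**  The χ assembly of
`ofV3ChiAt_of_dataSchemaT3XChiSel` against the v4 run package `RunAlphaV4ChiAC`: steps = χ-DATA + `hU`; `h71` BY MEMBERSHIP in `𝒞_Xs` through the seam row and `h68` ∕ r2 ∕ r3
by membership (all vacuous ∕ pinned at the trivial history); r1 and r2∕r3 at `triv` (k ≥ 1) = (D5), r3 at `k = 0` = (N1), terminal rows = measurability + (O‴χₛ).  NO comb letter,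
NO passage through `𝒞_X`.  HONEST YIELD: 2′χ's v4 ∃-package at FIXED `𝔠` modulo the DISPLAYED schema; nothing of the cluster expansion is proved.
[cite: Balaban1985UV3, Thm 2 p.272 + (40)–(42) p.266 + (47) p.267 + (67)–(71) p.273; Balaban1985Variational, Thm 1 (8) p.279] -/
theorem AlphaInputsT3AC.ofV4ChiAt_of_dataSchemaT3XsChiSel (D : DataSchemaT3ACXsChiSelV4 F 𝔠 a₀ a₁) : AlphaInputsT3AC.OfV4ChiAt F 𝔠 a₀ a₁ := by
  classical
  intro γ hγ hγ1 K
  obtain ⟨hN1, hseam, Ut, hT, hD⟩ := D γ hγ hγ1 K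
  obtain ⟨hUt0, hUtm, hr1, hr2t, hr3t⟩ := hT
  obtain ⟨UkH, hU0, ⟨hpin, hmeas, hmem⟩, 𝔖, 𝔄, hsteps, hPm, hPb⟩ := hD
  refine ⟨fun _ => Set.univ, fun k => UkH (k + 1) (Hist.triv (F.P K) (k + 1)), UkH, hU0, fun _ _ => rfl, 𝔖, 𝔄, ?_, ⟨?_, ?_, ?_⟩, ?_⟩
  · refine ⟨fun k hk => (hsteps k hk).toStepAlphaChi (fun h => hmeas k h), fun k hk h hh U e he => ?_, fun k hk h hh U => ?_⟩
    · by_cases ht : h = Hist.triv (F.P K) k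
      · have he' : e ∈ Hist.disc (P := F.P K) (Hist.triv (F.P K) k) := ht ▸ he
        rw [Hist.disc_triv] at he'
        exact absurd he' (Finset.notMem_empty e)
      · exact hseam k hk h hh U (UkH k h U) (hmem k hk h hh ht U) e he
    · by_cases ht : h = Hist.triv (F.P K) k
      · intro e he
        have he' : e ∈ Hist.disc (P := F.P K) (Hist.triv (F.P K) k) := ht ▸ he
        rw [Hist.disc_triv] at he'
        exact absurd he' (Finset.notMem_empty e)
      · exact AlphaInputsT3AC.h68_of_mem_adaptedClassT3Xs hk (hmem k hk h hh ht U)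
  · intro n hnK ε₁ ε₀ h1 h2 h3 h4 V hV
    rw [hpin]
    exact hr1 n hnK ε₁ ε₀ h1 h2 h3 h4 V hV
  · intro k hk h W hc b hb
    by_cases ht : h = Hist.triv (F.P K) k
    · subst ht
      rw [hpin]
      rcases Nat.eq_zero_or_pos k with rfl | hk0
      · show Ut 0 W b = W b
        rw [hUt0]
      · exact hr2t k hk0 hk W hc b hb
    · exact AlphaInputsT3AC.constraint42_of_mem_adaptedClassT3Xs (hmem k hk h hc.1 ht W) hc b hb
  · intro k hk h W hc i hi s hs q hq
    by_cases ht : h = Hist.triv (F.P K) k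
    · subst ht
      rw [hpin]
      rcases Nat.eq_zero_or_pos k with rfl | hk0
      · obtain rfl : i = 0 := Nat.le_zero.mp hi
        obtain rfl : s = 0 := Nat.le_zero.mp hs
        rw [lam42_self] at hq
        have hlt := hc.2 q (Finset.mem_coe.mpr hq)
        have h1 : (((F.L : ℝ) ^ (0 - 0))⁻¹) ^ 2 = 1 := by simp
        rw [h1, mul_one, Nat.sub_zero]
        show GaugeGroup.dist1 (GaugeField.plaqHol (Ut 0 W) q) ≤ _
        rw [hUt0]
        have hK1 : K - 0 + 1 = K + 1 := by simp
        rw [hK1] at hlt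
        exact (hlt.le).trans hN1
      · exact hr3t k hk0 hk W hc i hi s hs q hq
    · exact AlphaInputsT3AC.regularity68Levels_of_mem_adaptedClassT3Xs (hmem k hk h hc.1 ht W) hc i hi s hs q hq
  · exact ⟨fun h => hmeas K h, hPm, hPb⟩

end Construction

/-! ## §3 The knit from [7] Thm 1 (displayed) + closed-form sizes + the seam row + (O‴χₛ) for some pinned family -/

section Knit

open Literature.MathematicalPhysics.QuantumFieldTheory.Balaban1983to89.T3Thresholds (sqrt_le_exp_iff)

/-- ★ **THE v4 χ (α) PACKAGE FROM [7] THEOREM 1, THE SEAM ROW (71)_sym, THE PRINT-STRENGTH ROW (O‴χₛ) «for some pinned [7]-family whenever one exists», AND SIZES IN CLOSED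
FORM** — `ofV3ChiAt_of_pinnedRows₂SelChi` over `𝒞_Xs` and the v4 socket (the `C68`-rows give `hanti`∕`hsmall` by lane A's `MinimiserPin.anti_of_C68` ∕ `small_of_C68`; NO collar
size, NO (FL)). [cite: Balaban1985Variational, Thm 1 (6)–(8) pp.278–279; Balaban1985UV3, (40)–(42) p.266, (47) p.267, (67)–(71) p.273 and Thm 2 p.272] -/
theorem AlphaInputsT3AC.ofV4ChiAt_of_pinnedRows₂SelXsChi (F : T3Family) (𝔠 : AlphaConsts F.L (suGroupModel 2).N) {a₀ a₁ : ℝ}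
    (hT : Thm1GlobalMinAt F.L a₀ a₁ 𝔠.B₃) (ha₁ : 0 < a₁) (hwin : 𝔠.B₃ * a₁ ≤ a₀)
    (hA3 : (143 * ((((3 + 4 : ℕ) : ℝ)) ^ 2 / 4) ^ 2) * (2 * (𝔠.B₃ * a₁)) ≤ 1 / 3)
    (hA2 : 2 * (2 * (𝔠.B₃ * a₁)) ≤ 2 * deltaSU (Fin 2) / (((3 + 4) * F.L : ℕ) : ℝ) ^ 2)
    (hB₃ : 1 ≤ 2 * 𝔠.B₃) (hC : 4 * 𝔠.B₃ * (F.L : ℝ) ^ 2 * avgWindowFactor F.L ≤ 𝔠.C68)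
    (hCe : Real.exp (𝔠.p₀ - 1) ≤ 3 * C0 3 * 𝔠.C68 * (𝔠.b₀ * Q0 𝔠.p₀))
    (hCa : (𝔠.b₀ * Q0 𝔠.p₀) * (2 * (F.L : ℝ) ^ 2 * avgWindowFactor F.L) ^ 2 ≤ 3 * C0 3 * 𝔠.C68 * a₁ ^ 2)
    (hseam : ∀ (γ : ℝ) (hγ : 0 < γ) (hγ1 : γ ≤ (min 𝔠.gamma0 1) ^ 2) (K : ℕ), AlphaInputsT3AC.SmallFactor71OfRecT3 F 𝔠 γ hγ hγ1 K)
    (hrows : ∀ (γ : ℝ) (hγ : 0 < γ) (hγ1 : γ ≤ (min 𝔠.gamma0 1) ^ 2) (K : ℕ),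
      (∃ Ut : (k : ℕ) → GaugeField (F.P K) k (Matrix.specialUnitaryGroup (Fin 2) ℂ) → GaugeField (F.P K) 0 (Matrix.specialUnitaryGroup (Fin 2) ℂ),
        AlphaInputsT3AC.TrivMinimiserRowsT3 F 𝔠 γ hγ hγ1 a₀ a₁ K Ut) →
      ∃ Ut : (k : ℕ) → GaugeField (F.P K) k (Matrix.specialUnitaryGroup (Fin 2) ℂ) → GaugeField (F.P K) 0 (Matrix.specialUnitaryGroup (Fin 2) ℂ),
        AlphaInputsT3AC.TrivMinimiserRowsT3 F 𝔠 γ hγ hγ1 a₀ a₁ K Ut ∧ AlphaInputsT3AC.DataRowsT3XsChiSel F 𝔠 γ hγ hγ1 K Ut) :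
    AlphaInputsT3AC.OfV4ChiAt F 𝔠 a₀ a₁ := by
  have hL1 : 1 ≤ F.L := by have := F.hL.2; omega
  have hanti := MinimiserPin.anti_of_C68 𝔠 hCe
  have hsmall := MinimiserPin.small_of_C68 𝔠 hL1 ha₁ (avgWindowFactor_pos F) hCa
  refine AlphaInputsT3AC.ofV4ChiAt_of_dataSchemaT3XsChiSel fun γ hγ hγ1 K => ?_
  have hγ1' : γ ≤ 1 := hγ1.trans (sq_min_one_le _ 𝔠.gamma0_pos)
  have hγe : Real.sqrt γ ≤ Real.exp (1 - 𝔠.p₀) := (sqrt_le_exp_iff hγ.le).mpr (hγ1.trans hanti)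
  have hw0 : 0 ≤ (F.L : ℝ) ^ 2 * avgWindowFactor F.L := by
    have := avgWindowFactor_pos F
    positivity
  have hC2 : 2 * (F.L : ℝ) ^ 2 * avgWindowFactor F.L ≤ 𝔠.C68 := by nlinarith
  refine ⟨MinimiserPin.windowIneqT3_of_le F 𝔠 hγ hγ1' hγe hC2 K, hseam γ hγ hγ1 K, hrows γ hγ hγ1 K ?_⟩
  exact AlphaInputsT3AC.trivMinimiserRowsT3_of_thm1GlobalMinAt F 𝔠 γ hγ hγ1 K hT hwin hA3 hA2 hB₃
    (fun k _ => hsmall γ hγ hγ1 K k)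
    (fun k i hik hkK => MinimiserPin.C68_dom_of_le hL1 hγ hγ1' hγe 𝔠.b₀_pos 𝔠.p₀_pos.le (avgWindowFactor_pos F).le
      𝔠.B₃_pos.le hC K k i hik hkK)

end Knit

/-! ## §4 The record-parametric one-currency selection display over the v4 socket, and the registered v4 text 2′χ from it -/

/-- **2′χ (VERSION 4) DISPLAYED WITH A HANDED SELECTION IN ONE CURRENCY** (hypothesis schema, OPEN, never asserted): `PinnedPartsT3ACRecSelXsChi L` with the per-family seam row
`Large67CombOfRecT3` REPLACED by (71)_sym `SmallFactor71OfRecT3` — thresholds `(b₁, p₁)`, per profile the record constants with their sizes and `C68`-rows, [7] Thm 1, and per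
family the pair «(71)_sym at every `(γ, K)`» ∧ «(O‴χₛ) for some pinned [7]-family whenever one exists».  The display for PRINT's map under RULINGS g26-№8 ∕ №14.
[cite: Balaban1985UV3, (7) p.257, (40)–(42) p.266, (47) p.267, (67)–(71) p.273 and Thm 2 p.272; Balaban1985Variational, Thm 1 (6)–(8) pp.278–279] -/
def AlphaInputsT3AC.PinnedPartsT3ACRecSelXsV4Chi (L : ℕ) : Prop :=
  ∃ (b₁ p₁ : ℝ), ∀ (b₀ p₀ : ℝ), b₁ ≤ b₀ → p₁ ≤ p₀ →
    ∃ (𝔠 : AlphaConsts L (suGroupModel 2).N) (a₀ a₁ : ℝ), 𝔠.b₀ = b₀ ∧ 𝔠.p₀ = p₀ ∧ 0 < a₀ ∧ 0 < a₁ ∧ 𝔠.B₃ * a₁ ≤ a₀ ∧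
      (143 * ((((3 + 4 : ℕ) : ℝ)) ^ 2 / 4) ^ 2) * (2 * (𝔠.B₃ * a₁)) ≤ 1 / 3 ∧
      2 * (2 * (𝔠.B₃ * a₁)) ≤ 2 * deltaSU (Fin 2) / (((3 + 4) * L : ℕ) : ℝ) ^ 2 ∧
      1 ≤ 2 * 𝔠.B₃ ∧ 4 * 𝔠.B₃ * (L : ℝ) ^ 2 * avgWindowFactor L ≤ 𝔠.C68 ∧
      Real.exp (𝔠.p₀ - 1) ≤ 3 * C0 3 * 𝔠.C68 * (𝔠.b₀ * Q0 𝔠.p₀) ∧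
      (𝔠.b₀ * Q0 𝔠.p₀) * (2 * (L : ℝ) ^ 2 * avgWindowFactor L) ^ 2 ≤ 3 * C0 3 * 𝔠.C68 * a₁ ^ 2 ∧
      Thm1GlobalMinAt L a₀ a₁ 𝔠.B₃ ∧
      ∀ (F : T3Family) (hF : F.L = L),
        (∀ (γ : ℝ) (hγ : 0 < γ) (hγ1 : γ ≤ (min (hF ▸ 𝔠).gamma0 1) ^ 2) (K : ℕ), AlphaInputsT3AC.SmallFactor71OfRecT3 F (hF ▸ 𝔠) γ hγ hγ1 K) ∧
        ∀ (γ : ℝ) (hγ : 0 < γ) (hγ1 : γ ≤ (min (hF ▸ 𝔠).gamma0 1) ^ 2) (K : ℕ),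
          (∃ Ut : (k : ℕ) → GaugeField (F.P K) k (Matrix.specialUnitaryGroup (Fin 2) ℂ) → GaugeField (F.P K) 0 (Matrix.specialUnitaryGroup (Fin 2) ℂ),
            AlphaInputsT3AC.TrivMinimiserRowsT3 F (hF ▸ 𝔠) γ hγ hγ1 a₀ a₁ K Ut) →
          ∃ Ut : (k : ℕ) → GaugeField (F.P K) k (Matrix.specialUnitaryGroup (Fin 2) ℂ) → GaugeField (F.P K) 0 (Matrix.specialUnitaryGroup (Fin 2) ℂ),
            AlphaInputsT3AC.TrivMinimiserRowsT3 F (hF ▸ 𝔠) γ hγ hγ1 a₀ a₁ K Ut ∧ AlphaInputsT3AC.DataRowsT3XsChiSel F (hF ▸ 𝔠) γ hγ hγ1 K Ut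

/-- At a family of block size `L` the body of `PinnedPartsT3ACRecSelXsV4Chi` gives `OfV4ChiAt` (`ofV4ChiAt_of_pinnedRows₂SelXsChi` after transport along `hF`).
[cite: Balaban1985UV3, Thm 2 p.272 + (47) p.267 + (71) p.273; Balaban1985Variational, Thm 1 (8) p.279] -/
theorem AlphaInputsT3AC.ofV4ChiAt_of_pinnedPartsSelXsChi_cast {L : ℕ} {𝔠 : AlphaConsts L (suGroupModel 2).N} {a₀ a₁ : ℝ}
    (ha₁ : 0 < a₁) (hwin : 𝔠.B₃ * a₁ ≤ a₀)
    (hA3 : (143 * ((((3 + 4 : ℕ) : ℝ)) ^ 2 / 4) ^ 2) * (2 * (𝔠.B₃ * a₁)) ≤ 1 / 3)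
    (hA2 : 2 * (2 * (𝔠.B₃ * a₁)) ≤ 2 * deltaSU (Fin 2) / (((3 + 4) * L : ℕ) : ℝ) ^ 2)
    (hB₃ : 1 ≤ 2 * 𝔠.B₃) (hC : 4 * 𝔠.B₃ * (L : ℝ) ^ 2 * avgWindowFactor L ≤ 𝔠.C68)
    (hCe : Real.exp (𝔠.p₀ - 1) ≤ 3 * C0 3 * 𝔠.C68 * (𝔠.b₀ * Q0 𝔠.p₀))
    (hCa : (𝔠.b₀ * Q0 𝔠.p₀) * (2 * (L : ℝ) ^ 2 * avgWindowFactor L) ^ 2 ≤ 3 * C0 3 * 𝔠.C68 * a₁ ^ 2)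
    (hT : Thm1GlobalMinAt L a₀ a₁ 𝔠.B₃) (F : T3Family) (hF : F.L = L)
    (hseam : ∀ (γ : ℝ) (hγ : 0 < γ) (hγ1 : γ ≤ (min (hF ▸ 𝔠).gamma0 1) ^ 2) (K : ℕ), AlphaInputsT3AC.SmallFactor71OfRecT3 F (hF ▸ 𝔠) γ hγ hγ1 K)
    (hrows : ∀ (γ : ℝ) (hγ : 0 < γ) (hγ1 : γ ≤ (min (hF ▸ 𝔠).gamma0 1) ^ 2) (K : ℕ),
      (∃ Ut : (k : ℕ) → GaugeField (F.P K) k (Matrix.specialUnitaryGroup (Fin 2) ℂ) → GaugeField (F.P K) 0 (Matrix.specialUnitaryGroup (Fin 2) ℂ),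
        AlphaInputsT3AC.TrivMinimiserRowsT3 F (hF ▸ 𝔠) γ hγ hγ1 a₀ a₁ K Ut) →
      ∃ Ut : (k : ℕ) → GaugeField (F.P K) k (Matrix.specialUnitaryGroup (Fin 2) ℂ) → GaugeField (F.P K) 0 (Matrix.specialUnitaryGroup (Fin 2) ℂ),
        AlphaInputsT3AC.TrivMinimiserRowsT3 F (hF ▸ 𝔠) γ hγ hγ1 a₀ a₁ K Ut ∧ AlphaInputsT3AC.DataRowsT3XsChiSel F (hF ▸ 𝔠) γ hγ hγ1 K Ut) :
    AlphaInputsT3AC.OfV4ChiAt F (hF ▸ 𝔠) a₀ a₁ := by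
  subst hF
  exact AlphaInputsT3AC.ofV4ChiAt_of_pinnedRows₂SelXsChi F 𝔠 hT ha₁ hwin hA3 hA2 hB₃ hC hCe hCa hseam hrows

/-- ★★★ **THE VERSION-4 STUB TEXT 2′χ FROM ITS ONE-CURRENCY SELECTION DISPLAY**: `PinnedPartsT3ACRecSelXsV4Chi L → AlphaInputsT3ACv4RecChi L` — 2′χ (`stub_laneRecordsV4Chi`'s
text) re-cut to «(T) [7] Thm 1 + the record sizes + (71)_sym + (O‴χₛ) ONE measurable minimiser selection in `𝒞_Xs` with its χ data rows», NO comb letter, NO (FL), NO collar.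
[cite: Balaban1985UV3, Thm 2 p.272 + (47) p.267 + (67)–(71) p.273; Balaban1985Variational, Thm 1 (8) p.279] -/
theorem alphaInputsT3ACv4RecChi_of_pinnedPartsRecSelXsV4Chi {L : ℕ} (h : AlphaInputsT3AC.PinnedPartsT3ACRecSelXsV4Chi L) : AlphaInputsT3ACv4RecChi L := by
  obtain ⟨b₁, p₁, h⟩ := h
  refine ⟨b₁, p₁, fun b₀ p₀ hb hp => ?_⟩
  obtain ⟨𝔠, a₀, a₁, h1, h2, h3, h4, h5, hA3, hA2, hB₃, hC, hCe, hCa, hT, hD⟩ := h b₀ p₀ hb hp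
  exact ⟨𝔠, a₀, a₁, h1, h2, h3, h4, h5, fun F hF =>
    AlphaInputsT3AC.ofV4ChiAt_of_pinnedPartsSelXsChi_cast h4 h5 hA3 hA2 hB₃ hC hCe hCa hT F hF (hD F hF).1 (hD F hF).2⟩

end Summit.QuantumFields.YangMills.Theorems

/-! ## §5 The one-supplier twins in one currency over the v4 socket -/

namespace Summit.QuantumFields.YangMills.Theorems.HistoryTailSelSupplier

open MeasureTheory Set
open scoped Matrix.Norms.L2Operator
open Literature.MathematicalPhysics.QuantumFieldTheory.Balaban1983to89
open Literature.MathematicalPhysics.QuantumFieldTheory.Balaban1983to89.T3ContinuumYM3Torus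
open Literature.MathematicalPhysics.QuantumFieldTheory.Balaban1983to89.T3PrintedMinimiserExistence (Thm1GlobalMinAt)
open Literature.MathematicalPhysics.QuantumFieldTheory.Balaban1983to89.T3LowerAlongMinimisersSplit (MinimisersIn8At)
open Literature.MathematicalPhysics.QuantumFieldTheory.Balaban1983to89.ExpMeanLog (deltaSU)
open Literature.MathematicalPhysics.QuantumFieldTheory.Balaban1985CMP102.Setting
open Summit.QuantumFields.Balaban3D.Carriers
open Summit.QuantumFields.Balaban3D.Proofs.Primitives
open Summit.QuantumFields.Balaban3D.Proofs.Thresholds (Q0 Q0_pos)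
open Summit.QuantumFields.YangMills.Theorems.HistoryTailOneSupplier (exists_small_window)
open B7Prop2Explicit (C0 C0_pos)

/-- ★★ **THE v4 ONE-CURRENCY SELECTION DISPLAY FROM (T) AT ANY CONSTANTS AND THE SUPPLIER ROWS** — `pinnedPartsT3ACRecSelChi_of_thm1_rows` with the per-family∕`(γ, K)` supplier
row := «(71)_sym `SmallFactor71OfRecT3`» ∧ «(O‴χₛ) for some pinned [7]-family whenever one exists» (`B := max (max B₃ᵀ B₀) ½`; `exists_small_window`; `thm1GlobalMinAt_anti`∕`_mono`).
[cite: Balaban1985Variational, Thm 1 (6)–(8) pp.278–279; Balaban1985UV3, (7) p.257, (40)–(42) p.266, (47) p.267, (67)–(71) p.273 and Thm 2 p.272] -/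
theorem pinnedPartsT3ACRecSelXsV4Chi_of_thm1_rows {L : ℕ} (hL : 1 < L)
    (hT : ∃ a₀ a₁ B₃ : ℝ, 0 < a₀ ∧ 0 < a₁ ∧ 0 < B₃ ∧ Thm1GlobalMinAt L a₀ a₁ B₃)
    {B₀ A₀ A₁ : ℝ} (hA₀ : 0 < A₀) (hA₁ : 0 < A₁)
    (hrows : ∀ (B a₀ a₁ : ℝ), B₀ ≤ B → 1 ≤ 2 * B → 0 < a₀ → a₀ ≤ A₀ → 0 < a₁ → a₁ ≤ A₁ → B * a₁ ≤ a₀ →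
      (143 * ((((3 + 4 : ℕ) : ℝ)) ^ 2 / 4) ^ 2) * (2 * (B * a₁)) ≤ 1 / 3 →
      2 * (2 * (B * a₁)) ≤ 2 * deltaSU (Fin 2) / (((3 + 4) * L : ℕ) : ℝ) ^ 2 →
      Thm1GlobalMinAt L a₀ a₁ B →
      ∃ (b₁ p₁ : ℝ), ∀ (b₀ p₀ : ℝ), b₁ ≤ b₀ → p₁ ≤ p₀ →
        ∃ 𝔠 : AlphaConsts L (suGroupModel 2).N, 𝔠.b₀ = b₀ ∧ 𝔠.p₀ = p₀ ∧ 𝔠.B₃ = B ∧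
          4 * 𝔠.B₃ * (L : ℝ) ^ 2 * avgWindowFactor L ≤ 𝔠.C68 ∧
          Real.exp (𝔠.p₀ - 1) ≤ 3 * C0 3 * 𝔠.C68 * (𝔠.b₀ * Q0 𝔠.p₀) ∧
          (𝔠.b₀ * Q0 𝔠.p₀) * (2 * (L : ℝ) ^ 2 * avgWindowFactor L) ^ 2 ≤ 3 * C0 3 * 𝔠.C68 * a₁ ^ 2 ∧
          ∀ (F : T3Family) (hF : F.L = L),
            (∀ (γ : ℝ) (hγ : 0 < γ) (hγ1 : γ ≤ (min (hF ▸ 𝔠).gamma0 1) ^ 2) (K : ℕ),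
              AlphaInputsT3AC.SmallFactor71OfRecT3 F (hF ▸ 𝔠) γ hγ hγ1 K) ∧
            ∀ (γ : ℝ) (hγ : 0 < γ) (hγ1 : γ ≤ (min (hF ▸ 𝔠).gamma0 1) ^ 2) (K : ℕ),
              (∃ Ut : (k : ℕ) → GaugeField (F.P K) k (Matrix.specialUnitaryGroup (Fin 2) ℂ) →
                  GaugeField (F.P K) 0 (Matrix.specialUnitaryGroup (Fin 2) ℂ),
                AlphaInputsT3AC.TrivMinimiserRowsT3 F (hF ▸ 𝔠) γ hγ hγ1 a₀ a₁ K Ut) →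
              ∃ Ut : (k : ℕ) → GaugeField (F.P K) k (Matrix.specialUnitaryGroup (Fin 2) ℂ) →
                  GaugeField (F.P K) 0 (Matrix.specialUnitaryGroup (Fin 2) ℂ),
                AlphaInputsT3AC.TrivMinimiserRowsT3 F (hF ▸ 𝔠) γ hγ hγ1 a₀ a₁ K Ut ∧
                  AlphaInputsT3AC.DataRowsT3XsChiSel F (hF ▸ 𝔠) γ hγ hγ1 K Ut) :
    AlphaInputsT3AC.PinnedPartsT3ACRecSelXsV4Chi L := by
  obtain ⟨aT₀, aT₁, BT, haT₀, haT₁, hBT, hT⟩ := hT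
  set B : ℝ := max (max BT B₀) (1 / 2) with hB_def
  have hBT_le : BT ≤ B := (le_max_left _ _).trans (le_max_left _ _)
  have hB₀_le : B₀ ≤ B := (le_max_right _ _).trans (le_max_left _ _)
  have hBhalf : 1 / 2 ≤ B := le_max_right _ _
  have hBpos : 0 < B := lt_of_lt_of_le (by norm_num) hBhalf
  have h2B : 1 ≤ 2 * B := by linarith
  obtain ⟨a₀, a₁, ha₀, ha₀A, ha₁, ha₁A, hwin, hA3, hA2⟩ :=
    exists_small_window hL hBpos (lt_min hA₀ haT₀) (lt_min hA₁ haT₁)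
  have hT' : Thm1GlobalMinAt L a₀ a₁ B :=
    MinimiserPin.thm1GlobalMinAt_mono
      (MinimiserPin.thm1GlobalMinAt_anti hT (ha₀A.trans (min_le_right _ _)) (ha₁A.trans (min_le_right _ _))) le_rfl hBT_le
  obtain ⟨b₁, p₁, hrec⟩ := hrows B a₀ a₁ hB₀_le h2B ha₀ (ha₀A.trans (min_le_left _ _)) ha₁ (ha₁A.trans (min_le_left _ _))
    hwin hA3 hA2 hT'
  refine ⟨b₁, p₁, fun b₀ p₀ hb hp => ?_⟩
  obtain ⟨𝔠, h1, h2, hB3, s1, s2, s3, hFO⟩ := hrec b₀ p₀ hb hp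
  refine ⟨𝔠, a₀, a₁, h1, h2, ha₀, ha₁, by rw [hB3]; exact hwin, by rw [hB3]; exact hA3, by rw [hB3]; exact hA2,
    by rw [hB3]; exact h2B, s1, s2, s3, by rw [hB3]; exact hT', fun F hF => hFO F hF⟩

/-- ★★★ **THE v5p10 STUB TEXT `∀ L, Odd L → 1 < L → AlphaInputsT3ACv4RecChi L` ⇐ ⟨v5kC∕v5kD's `stub_thm1In8GlobalMin` TEXT⟩ ∧ (∀ odd `L > 1`, THE ONE-CURRENCY v4 SUPPLIER
ROWS)** — at every odd block size a floor `B₀` and a box `(0, A₀] × (0, A₁]` on which the record rows and, per family∕`(γ, K)`, the seam row (71)_sym and ONE measurable minimiser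
selection in `𝒞_Xs` with its [Balaban1985UV3] Sect. B–C χ-data (O‴χₛ) are served — print's own shape; NO comb letter, NO (FL), NO collar.  (The door `⇒ HistoryTailL` is the v4 chain
P5–P20, not this file.) [cite: Balaban1985UV3, (5) p.256, (47) p.267, (67)–(71) p.273 and Thm 2 p.272; Balaban1985Variational, Thm 1 (8) p.279 and Prop 8 p.304] -/
theorem laneRecordsV4Chi_of_thm1In8_selXsDataRows_allL
    (hT8 : ∀ L : ℕ, Odd L → 1 < L → ∃ a₀ a₁ B₃ : ℝ, 0 < a₀ ∧ 0 < a₁ ∧ 0 < B₃ ∧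
      Thm1GlobalMinAt L a₀ a₁ B₃ ∧ MinimisersIn8At L a₀ a₁ B₃)
    (hrows : ∀ L : ℕ, Odd L → 1 < L → ∃ (B₀ A₀ A₁ : ℝ), 0 < A₀ ∧ 0 < A₁ ∧
      ∀ (B a₀ a₁ : ℝ), B₀ ≤ B → 1 ≤ 2 * B → 0 < a₀ → a₀ ≤ A₀ → 0 < a₁ → a₁ ≤ A₁ → B * a₁ ≤ a₀ →
        (143 * ((((3 + 4 : ℕ) : ℝ)) ^ 2 / 4) ^ 2) * (2 * (B * a₁)) ≤ 1 / 3 →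
        2 * (2 * (B * a₁)) ≤ 2 * deltaSU (Fin 2) / (((3 + 4) * L : ℕ) : ℝ) ^ 2 →
        Thm1GlobalMinAt L a₀ a₁ B →
        ∃ (b₁ p₁ : ℝ), ∀ (b₀ p₀ : ℝ), b₁ ≤ b₀ → p₁ ≤ p₀ →
          ∃ 𝔠 : AlphaConsts L (suGroupModel 2).N, 𝔠.b₀ = b₀ ∧ 𝔠.p₀ = p₀ ∧ 𝔠.B₃ = B ∧
            4 * 𝔠.B₃ * (L : ℝ) ^ 2 * avgWindowFactor L ≤ 𝔠.C68 ∧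
            Real.exp (𝔠.p₀ - 1) ≤ 3 * C0 3 * 𝔠.C68 * (𝔠.b₀ * Q0 𝔠.p₀) ∧
            (𝔠.b₀ * Q0 𝔠.p₀) * (2 * (L : ℝ) ^ 2 * avgWindowFactor L) ^ 2 ≤ 3 * C0 3 * 𝔠.C68 * a₁ ^ 2 ∧
            ∀ (F : T3Family) (hF : F.L = L),
              (∀ (γ : ℝ) (hγ : 0 < γ) (hγ1 : γ ≤ (min (hF ▸ 𝔠).gamma0 1) ^ 2) (K : ℕ),
                AlphaInputsT3AC.SmallFactor71OfRecT3 F (hF ▸ 𝔠) γ hγ hγ1 K) ∧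
              ∀ (γ : ℝ) (hγ : 0 < γ) (hγ1 : γ ≤ (min (hF ▸ 𝔠).gamma0 1) ^ 2) (K : ℕ),
                (∃ Ut : (k : ℕ) → GaugeField (F.P K) k (Matrix.specialUnitaryGroup (Fin 2) ℂ) →
                    GaugeField (F.P K) 0 (Matrix.specialUnitaryGroup (Fin 2) ℂ),
                  AlphaInputsT3AC.TrivMinimiserRowsT3 F (hF ▸ 𝔠) γ hγ hγ1 a₀ a₁ K Ut) →
                ∃ Ut : (k : ℕ) → GaugeField (F.P K) k (Matrix.specialUnitaryGroup (Fin 2) ℂ) →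
                    GaugeField (F.P K) 0 (Matrix.specialUnitaryGroup (Fin 2) ℂ),
                  AlphaInputsT3AC.TrivMinimiserRowsT3 F (hF ▸ 𝔠) γ hγ hγ1 a₀ a₁ K Ut ∧
                    AlphaInputsT3AC.DataRowsT3XsChiSel F (hF ▸ 𝔠) γ hγ hγ1 K Ut) :
    ∀ L : ℕ, Odd L → 1 < L → AlphaInputsT3ACv4RecChi L := by
  intro L hLo hL
  obtain ⟨a₀, a₁, B₃, ha₀, ha₁, hB₃, hT, -⟩ := hT8 L hLo hL
  obtain ⟨B₀, A₀, A₁, hA₀, hA₁, h⟩ := hrows L hLo hL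
  exact alphaInputsT3ACv4RecChi_of_pinnedPartsRecSelXsV4Chi
    (pinnedPartsT3ACRecSelXsV4Chi_of_thm1_rows hL ⟨a₀, a₁, B₃, ha₀, ha₁, hB₃, hT⟩ hA₀ hA₁ h)

end Summit.QuantumFields.YangMills.Theorems.HistoryTailSelSupplier

end
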